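import Literature.NumberTheory.EllipticCurves.BinaryQuarticTwoCoveringsCocycle
import HarnessLib

/-!
# Two-coverings attached to binary quartic forms, III: the isomorphism `ψ_u : C_f → E_{A,B}` and
# the local torsor lemma (the class is trivial over `K` iff `z² = f(x, y)` is `K`-soluble)

Topic `Literature/NumberTheory/EllipticCurves`. Third file of the theory proving the named fact
`Literature.NumberTheory.EllipticCurves.bhargavaShankar_card_selmerTwo_eq_kEquivClassCount`
(`BinaryQuarticMinimisation.lean`; Bhargava–Shankar 2015, held arXiv text §5.1, Lemma 5.2).

Let `f` be a binary quartic form over a field `Ω ⊇ K` (the base change of a form `g` over `K`)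
with `a ≠ 0`, `Δ ≠ 0`, `I(f) = −3At⁴`, `J(f) = −27Bt⁶`, and let `u ∈ Ω` be a root of `f(x, 1)`.
Sending `u` to infinity puts the `2`-covering `C_f : z² = f(x, y)` (weighted projective
coordinates `(x : y : z)`, weights `1, 1, 2`) in Weierstrass form; explicitly, with
`f₁(u) = ∂f/∂x(u, 1)`, `f₂(u) = ∂²f/∂x²(u, 1)`:

* `ψ_u(x : y : z) = ( (f₁(u)·y/(x − uy) + f₂(u)/6)/t² , f₁(u)·z/((x − uy)²t³) ) ∈ E_{A,B}` for
  `x ≠ uy`, and `ψ_u(u : 1 : 0) = O` (`TwoCovering.psiPt`; `psi_equation`: it lands on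
  `E_{A,B} : Y² = X³ + AX + B`). This is Cremona's `θ_u` (Cremona 2001, §4, before Prop. 4.3: "a
  transformation … such that `A(x₁) = ∞` takes the other roots `x_j` … to the roots of `F̃`",
  `θ₁` maps `(x₁, 0)` to `O`), normalised to `E_{A,B}`;
* **torsor compatibility** `ψ_v(Q) = ψ_u(Q) + T(u, v)` for roots `u, v`
  (`psiPt_eq_psiPt_add_torsorPt`) — Cremona 2001, Prop. 4.3 (3): `θ^σ(R) = θ(R) + T_σ` — and the
  explicit inverse `χ_u` (`chiTriple`) with `ψ_u ∘ χ_u = id`, `χ_u ∘ ψ_u ∼ id`;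
* **the local torsor lemma** (Cremona 2001, §5: "such cocycles become trivial in
  `H¹(Gal(K̄/K), E)`, as is evident from their representation as the coboundary `Q^σ − Q` with
  `Q = θ(R) ∈ E(K̄)`", and conversely Prop. 4.3 (4)–(5); Cassels, LEC §23: "being in the kernel
  means … that there is a point on `𝒟` defined over `ℚ_p`"): the cocycle `σ ↦ T(r₀, σ r₀)` of
  `Gal(K̄/K)` is a coboundary `σP − P` in `E(K̄)` **iff** `z² = g(x, y)` has a `K`-rational point
  (`exists_eq_map_sub_of_isSoluble`, `isSoluble_of_forall_eq_map_sub`).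

Combined with `selmerClass_mem_selmerLocalKer_iff` (file II) this identifies the local Selmer
conditions on the class of `g` with the local solubility of `g`.

## References

* J. E. Cremona, *Classical invariants and 2-descent on elliptic curves*, J. Symbolic Comput. 31
  (2001) 71–87, §4 (the maps `θ_i`, Prop. 4.3) and §5. [Cremona2001]
* M. Bhargava, A. Shankar, Ann. of Math. (2) 181 (2015), §5.1 of arXiv:1006.1002v2, Lemma 5.2.
  [BhargavaShankarAnnals2015]
* J. W. S. Cassels, *Lectures on Elliptic Curves* (1991), §23.

## Design

Points of `C_f` are handled as bare triples `(x, y, z)` with `(x, y) ≠ (0, 0)` and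
`z² = f(x, y)`, up to the weighted scaling `(λx, λy, λ²z)`; `psiPt` is a total function with
value `O` off the locus where the formula gives a nonsingular point (as `torsorPt` in file I).
All identities are proved for `ofRootVec a r` by `field_simp`/`ring`/`linear_combination` and
transported along root data (re-indexed by `S₄` to the roots `r₀, r₁`).
-/

noncomputable section

open scoped Classical

universe u

namespace Literature.NumberTheory.EllipticCurves

namespace BinaryQuartic

/-! ## §0 Derivatives of the quartic at a root -/

section Deriv

variable {F S : Type*} [Field F] [Field S]

/-- `f₁(u) = ∂f/∂x (u, 1) = 4au³ + 3bu² + 2cu + d`. [folklore] -/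
def derivX (f : BinaryQuartic F) (u : F) : F :=
  4 * f.a * u ^ 3 + 3 * f.b * u ^ 2 + 2 * f.c * u + f.d

/-- `f₂(u) = ∂²f/∂x² (u, 1) = 12au² + 6bu + 2c`. [folklore] -/
def derivXX (f : BinaryQuartic F) (u : F) : F :=
  12 * f.a * u ^ 2 + 6 * f.b * u + 2 * f.c

/-- `f₁` commutes with field homomorphisms. [folklore] -/
theorem derivX_map (ψ : F →+* S) (f : BinaryQuartic F) (u : F) :
    derivX (f.map ψ) (ψ u) = ψ (derivX f u) := by
  simp [derivX, BinaryQuartic.map, map_ofNat]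

/-- `f₂` commutes with field homomorphisms. [folklore] -/
theorem derivXX_map (ψ : F →+* S) (f : BinaryQuartic F) (u : F) :
    derivXX (f.map ψ) (ψ u) = ψ (derivXX f u) := by
  simp [derivXX, BinaryQuartic.map, map_ofNat]

/-- At the root `r₀` of `a ∏ᵢ (x − rᵢ y)`: `f₁(r₀) = a (r₀ − r₁)(r₀ − r₂)(r₀ − r₃)`. [folklore] -/
theorem derivX_ofRootVec_zero (a : F) (r : Fin 4 → F) :
    derivX (ofRootVec a r) (r 0) = a * ((r 0 - r 1) * (r 0 - r 2) * (r 0 - r 3)) := by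
  simp only [derivX, ofRootVec, ofRoots]; ring

/-- Any index is the image of `0` under a permutation of `Fin 4`. [folklore] -/
theorem exists_perm_fin_four_zero (i : Fin 4) : ∃ σ : Equiv.Perm (Fin 4), σ 0 = i := by
  revert i; decide

/-- Any two distinct indices are the images of `0, 1` under a permutation of `Fin 4`. [folklore] -/
theorem exists_perm_fin_four_zero_one {i j : Fin 4} (hij : i ≠ j) :
    ∃ σ : Equiv.Perm (Fin 4), σ 0 = i ∧ σ 1 = j := by
  revert i j; decide

/-- For root data with `a ≠ 0`, `Δ ≠ 0`: `f₁(rᵢ) ≠ 0` (the roots are simple). [folklore] -/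
theorem RootData.derivX_ne_zero {f : BinaryQuartic F} (R : RootData f) (ha : f.a ≠ 0)
    (hΔ : f.disc ≠ 0) (i : Fin 4) : derivX f (R.r i) ≠ 0 := by
  obtain ⟨σ, h0⟩ := exists_perm_fin_four_zero i
  have hinj := (R.reindex σ).injective hΔ
  have h := derivX_ofRootVec_zero f.a (R.reindex σ).r
  rw [← (R.reindex σ).eq_ofRoots] at h
  simp only [RootData.reindex_r, h0] at h
  rw [h]
  refine mul_ne_zero ha (mul_ne_zero (mul_ne_zero ?_ ?_) ?_) <;> rw [sub_ne_zero] <;> intro he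
  · exact absurd (hinj (show (R.reindex σ).r 0 = (R.reindex σ).r 1 by simpa [h0] using he)) (by decide)
  · exact absurd (hinj (show (R.reindex σ).r 0 = (R.reindex σ).r 2 by simpa [h0] using he)) (by decide)
  · exact absurd (hinj (show (R.reindex σ).r 0 = (R.reindex σ).r 3 by simpa [h0] using he)) (by decide)

/-- Homogeneity: `f(λx, λy) = λ⁴ f(x, y)` (local copy of the tree's
`BinaryQuartic.eval_scale` of `BinaryQuarticCovariants.lean`, not imported here). [folklore] -/
theorem eval_scale {R₀ : Type*} [CommRing R₀] (f : BinaryQuartic R₀) (l x y : R₀) :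
    f.eval (l * x) (l * y) = l ^ 4 * f.eval x y := by
  simp only [BinaryQuartic.eval]; ring

end Deriv

end BinaryQuartic

namespace TwoCovering

open BinaryQuartic WeierstrassCurve WeierstrassCurve.Affine

/-! ## §1 The map `ψ_u : C_f → E` -/

section Psi

variable {F S : Type*} [Field F] [Field S]

/-- The `X`-coordinate of `ψ_u(x : y : z)`: `(f₁(u)·y/(x − uy) + f₂(u)/6)/t²`.
[cite: Cremona2001, §4 (the maps θ_i, before Prop. 4.3)] -/
def psiX (f : BinaryQuartic F) (t u x y : F) : F :=
  (derivX f u * y / (x - u * y) + derivXX f u / 6) / t ^ 2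

/-- The `Y`-coordinate of `ψ_u(x : y : z)`: `f₁(u)·z/((x − uy)² t³)`.
[cite: Cremona2001, §4 (the maps θ_i, before Prop. 4.3)] -/
def psiY (f : BinaryQuartic F) (t u x y z : F) : F :=
  derivX f u * z / ((x - u * y) ^ 2 * t ^ 3)

/-- `psiX` commutes with field homomorphisms. [folklore] -/
theorem psiX_map (ψ : F →+* S) (f : BinaryQuartic F) (t u x y : F) :
    psiX (f.map ψ) (ψ t) (ψ u) (ψ x) (ψ y) = ψ (psiX f t u x y) := by
  simp [psiX, derivX_map, derivXX_map, map_ofNat]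

/-- `psiY` commutes with field homomorphisms. [folklore] -/
theorem psiY_map (ψ : F →+* S) (f : BinaryQuartic F) (t u x y z : F) :
    psiY (f.map ψ) (ψ t) (ψ u) (ψ x) (ψ y) (ψ z) = ψ (psiY f t u x y z) := by
  simp [psiY, derivX_map]

variable (C : Affine F)

/-- **The map `ψ_u : C_f → E`** on weighted-projective triples `(x : y : z)` of `z² = f(x, y)`:
the point `(psiX, psiY)` of `C` when `x ≠ uy` and this is a nonsingular point of `C`, and `O`
otherwise (so `ψ_u(u : 1 : 0) = O`: the ramification point above the root `u` goes to the
origin). Cremona's `θ_u` (2001, §4), normalised to land on `E_{A,B}`.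
[cite: Cremona2001, §4 (the maps θ_i) and Prop. 4.3] -/
def psiPt (f : BinaryQuartic F) (t u x y z : F) : C.Point :=
  if h : x - u * y ≠ 0 ∧ C.Nonsingular (psiX f t u x y) (psiY f t u x y z) then .some _ _ h.2
  else 0

variable {C}

/-- `ψ_u` of the ramification point above `u` (and of anything with `x = uy`) is `O`. [folklore] -/
theorem psiPt_of_eq_zero (f : BinaryQuartic F) (t : F) {u x y : F} (z : F) (h : x - u * y = 0) :
    psiPt C f t u x y z = 0 := by
  rw [psiPt, dif_neg]
  exact fun h' ↦ h'.1 h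

/-- `ψ_u(x : y : z) = (psiX, psiY)` when `x ≠ uy` and the point is nonsingular. [folklore] -/
theorem psiPt_of_nonsingular {f : BinaryQuartic F} {t u x y z : F} (hx : x - u * y ≠ 0)
    (h : C.Nonsingular (psiX f t u x y) (psiY f t u x y z)) : psiPt C f t u x y z = .some _ _ h := by
  rw [psiPt, dif_pos ⟨hx, h⟩]

end Psi

/-! ## §2 `ψ_u` lands on `E_{A,B}` -/

section Equation

variable {F : Type*} [Field F]

/-- The Weierstrass equation for `ψ_{r₀}` on `ofRootVec a r`: if `z² = f(x, y)` and `x ≠ r₀y` then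
`psiY² = psiX³ + A·psiX + B` with `A = −I/(3t⁴)`, `B = −J/(27t⁶)` (sending the root to infinity
transforms `z² = f` into `Y² = X³ − 27IX − 27J` up to the normalisation; Cremona 2001, §4).
[cite: Cremona2001, §4 (C is birational to E_{I,J} over K(x_i))] -/
theorem psi_equation_ofRootVec (a : F) (r : Fin 4 → F) {t x y z : F} (h2 : (2 : F) ≠ 0)
    (h3 : (3 : F) ≠ 0) (ht : t ≠ 0) (hx : x - r 0 * y ≠ 0) (hz : z ^ 2 = (ofRootVec a r).eval x y) :
    psiY (ofRootVec a r) t (r 0) x y z ^ 2 =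
      psiX (ofRootVec a r) t (r 0) x y ^ 3 + -(ofRootVec a r).I / (3 * t ^ 4) *
        psiX (ofRootVec a r) t (r 0) x y + -(ofRootVec a r).J / (27 * t ^ 6) := by
  have hY : psiY (ofRootVec a r) t (r 0) x y z ^ 2 =
      derivX (ofRootVec a r) (r 0) ^ 2 * (ofRootVec a r).eval x y / ((x - r 0 * y) ^ 2 * t ^ 3) ^ 2 := by
    rw [psiY, div_pow, mul_pow, hz]
  rw [hY]
  have h6 : (6 : F) ≠ 0 := by
    have : (6 : F) = 2 * 3 := by norm_num
    rw [this]; exact mul_ne_zero h2 h3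
  have h27 : (27 : F) ≠ 0 := by
    have : (27 : F) = 3 * 3 * 3 := by norm_num
    rw [this]; exact mul_ne_zero (mul_ne_zero h3 h3) h3
  simp only [psiX, derivX, derivXX, ofRootVec, ofRoots, BinaryQuartic.I, BinaryQuartic.J,
    BinaryQuartic.eval]
  field_simp
  ring

variable {f : BinaryQuartic F} (R : RootData f) {A B t : F}

/-- **`ψ_u` lands on `E_{A,B}`**: for a root `rᵢ`, `x ≠ rᵢy` and `z² = f(x,y)`,
`psiY² = psiX³ + A·psiX + B`. [cite: Cremona2001, §4 (C is birational to E over K(x_i)) and Prop. 4.3] -/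
theorem psi_equation (h2 : (2 : F) ≠ 0) (h3 : (3 : F) ≠ 0) (ht : t ≠ 0)
    (hI : f.I = -3 * A * t ^ 4) (hJ : f.J = -27 * B * t ^ 6) (i : Fin 4) {x y z : F}
    (hx : x - R.r i * y ≠ 0) (hz : z ^ 2 = f.eval x y) :
    psiY f t (R.r i) x y z ^ 2 = psiX f t (R.r i) x y ^ 3 + A * psiX f t (R.r i) x y + B := by
  -- re-index so that `i` becomes `0`
  obtain ⟨σ, h0⟩ := exists_perm_fin_four_zero i
  have h27 : (27 : F) ≠ 0 := by
    have : (27 : F) = 3 * 3 * 3 := by norm_num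
    rw [this]; exact mul_ne_zero (mul_ne_zero h3 h3) h3
  have hA : A = -f.I / (3 * t ^ 4) := by
    rw [hI]; field_simp
  have hB : B = -f.J / (27 * t ^ 6) := by
    rw [hJ]; field_simp
  set R' := R.reindex σ with hR'
  have hx' : x - R'.r 0 * y ≠ 0 := by simpa [hR', h0] using hx
  have hx'' : x - R'.r 0 * y ≠ 0 := hx'
  have hz' : z ^ 2 = (ofRootVec f.a R'.r).eval x y := by rw [← R'.eq_ofRoots]; exact hz
  have h := psi_equation_ofRootVec f.a R'.r h2 h3 ht hx'' hz'
  rw [← R'.eq_ofRoots] at h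
  have hr : R'.r 0 = R.r i := by simp [hR', h0]
  rw [hr] at h
  rw [hA, hB, h]

variable {C : Affine F} (hC : IsShortModel C A B)
include hC

/-- `ψ_{rᵢ}(x : y : z)` is a nonsingular point of `E_{A,B}` (for `x ≠ rᵢy`, `z² = f(x,y)`).
[folklore] -/
theorem nonsingular_psi (h2 : (2 : F) ≠ 0) (h3 : (3 : F) ≠ 0) (ht : t ≠ 0)
    (hI : f.I = -3 * A * t ^ 4) (hJ : f.J = -27 * B * t ^ 6) (hE : 4 * A ^ 3 + 27 * B ^ 2 ≠ 0)
    (i : Fin 4) {x y z : F} (hx : x - R.r i * y ≠ 0) (hz : z ^ 2 = f.eval x y) :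
    C.Nonsingular (psiX f t (R.r i) x y) (psiY f t (R.r i) x y z) := by
  have hΔ : C.Δ ≠ 0 := by
    rw [hC.Δ_eq]
    refine mul_ne_zero ?_ hE
    have : (-16 : F) = -(2 * 2 * 2 * 2) := by norm_num
    rw [this, neg_ne_zero]
    exact mul_ne_zero (mul_ne_zero (mul_ne_zero h2 h2) h2) h2
  rw [← equation_iff_nonsingular_of_Δ_ne_zero hΔ, hC.equation_iff]
  exact psi_equation R h2 h3 ht hI hJ i hx hz

/-- `ψ_{rᵢ}(x : y : z) = (psiX, psiY)` explicitly (for `x ≠ rᵢy`, `z² = f(x,y)`). [folklore] -/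
theorem psiPt_eq_some (h2 : (2 : F) ≠ 0) (h3 : (3 : F) ≠ 0) (ht : t ≠ 0)
    (hI : f.I = -3 * A * t ^ 4) (hJ : f.J = -27 * B * t ^ 6) (hE : 4 * A ^ 3 + 27 * B ^ 2 ≠ 0)
    (i : Fin 4) {x y z : F} (hx : x - R.r i * y ≠ 0) (hz : z ^ 2 = f.eval x y) :
    psiPt C f t (R.r i) x y z = .some _ _ (nonsingular_psi R hC h2 h3 ht hI hJ hE i hx hz) :=
  psiPt_of_nonsingular hx _

end Equation

/-! ## §3 Torsor compatibility: `ψ_v = ψ_u + T(u, v)` -/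

section Compat

variable {F : Type*} [Field F]

/-- `psiX_{r₀} − x(r₀, r₁) = f₁(r₀)(x − r₁y)/((r₀ − r₁) t² (x − r₀y))` on `ofRootVec a r`: the
function `X ∘ ψ_{r₀} − e` has divisor `2(R_{r₁}) − 2(R_{r₀})` on `C_f`. [folklore] -/
theorem psiX_sub_torsX_ofRootVec (a : F) (r : Fin 4 → F) {t x y : F} (h2 : (2 : F) ≠ 0)
    (h3 : (3 : F) ≠ 0) (ht : t ≠ 0) (hx : x - r 0 * y ≠ 0) (h01 : r 0 - r 1 ≠ 0) :
    psiX (ofRootVec a r) t (r 0) x y - torsX (ofRootVec a r) t (r 0) (r 1) =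
      derivX (ofRootVec a r) (r 0) * (x - r 1 * y) / ((r 0 - r 1) * t ^ 2 * (x - r 0 * y)) := by
  have h6 : (6 : F) ≠ 0 := by
    have : (6 : F) = 2 * 3 := by norm_num
    rw [this]; exact mul_ne_zero h2 h3
  simp only [psiX, torsX, phi, derivX, derivXX, ofRootVec, ofRoots]
  field_simp
  ring

/-- `psiX_{r₁}(r₀y : y) = x(r₀, r₁)`: `ψ_{r₁}` maps the ramification point above `r₀` to `T(r₀, r₁)`
(Cremona 2001, §4: `θ₁` takes the other points `(x_j, 0)` to the points of order `2`). [cite: Cremona2001, §4 p. 82] -/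
theorem psiX_ramification_ofRootVec (a : F) (r : Fin 4 → F) {t y : F} (h2 : (2 : F) ≠ 0)
    (h3 : (3 : F) ≠ 0) (ht : t ≠ 0) (hy : y ≠ 0) (h01 : r 0 - r 1 ≠ 0) :
    psiX (ofRootVec a r) t (r 1) (r 0 * y) y = torsX (ofRootVec a r) t (r 0) (r 1) := by
  have h6 : (6 : F) ≠ 0 := by
    have : (6 : F) = 2 * 3 := by norm_num
    rw [this]; exact mul_ne_zero h2 h3
  have h10 : r 0 * y - r 1 * y ≠ 0 := by
    rw [← sub_mul]; exact mul_ne_zero h01 hy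
  simp only [psiX, torsX, phi, derivX, derivXX, ofRootVec, ofRoots]
  field_simp
  ring

/-- The addition `ψ_{r₀}(Q) + T(r₀, r₁)` in coordinates, `X`-part: with
`ℓ = (r₀ − r₁) z/(t (x − r₀y)(x − r₁y))` (the slope of the chord), `ℓ² − psiX_{r₀} − x(r₀,r₁) =
psiX_{r₁}` on `z² = f(x,y)`. [folklore] -/
theorem addX_psi_ofRootVec (a : F) (r : Fin 4 → F) {t x y z : F} (h2 : (2 : F) ≠ 0)
    (h3 : (3 : F) ≠ 0) (ht : t ≠ 0) (hx0 : x - r 0 * y ≠ 0) (hx1 : x - r 1 * y ≠ 0)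
    (hz : z ^ 2 = (ofRootVec a r).eval x y) :
    ((r 0 - r 1) * z / (t * (x - r 0 * y) * (x - r 1 * y))) ^ 2 - psiX (ofRootVec a r) t (r 0) x y -
        torsX (ofRootVec a r) t (r 0) (r 1) = psiX (ofRootVec a r) t (r 1) x y := by
  have h6 : (6 : F) ≠ 0 := by
    have : (6 : F) = 2 * 3 := by norm_num
    rw [this]; exact mul_ne_zero h2 h3
  rw [div_pow, mul_pow, hz]
  simp only [psiX, torsX, phi, derivX, derivXX, ofRootVec, ofRoots, BinaryQuartic.eval]
  field_simp
  ring

/-- The addition `ψ_{r₀}(Q) + T(r₀, r₁)` in coordinates, `Y`-part: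
`ℓ (psiX_{r₀} − psiX_{r₁}) − psiY_{r₀} = psiY_{r₁}`. [folklore] -/
theorem addY_psi_ofRootVec (a : F) (r : Fin 4 → F) {t x y : F} (z : F) (h2 : (2 : F) ≠ 0)
    (h3 : (3 : F) ≠ 0) (ht : t ≠ 0) (hx0 : x - r 0 * y ≠ 0) (hx1 : x - r 1 * y ≠ 0) :
    (r 0 - r 1) * z / (t * (x - r 0 * y) * (x - r 1 * y)) *
        (psiX (ofRootVec a r) t (r 0) x y - psiX (ofRootVec a r) t (r 1) x y) -
        psiY (ofRootVec a r) t (r 0) x y z = psiY (ofRootVec a r) t (r 1) x y z := by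
  have h6 : (6 : F) ≠ 0 := by
    have : (6 : F) = 2 * 3 := by norm_num
    rw [this]; exact mul_ne_zero h2 h3
  simp only [psiX, psiY, derivX, derivXX, ofRootVec, ofRoots]
  field_simp
  ring

variable {f : BinaryQuartic F} (R : RootData f) {A B t : F} {C : Affine F} (hC : IsShortModel C A B)
include hC

omit hC in
/-- A point of `C_f` with `x = rᵢy` is the ramification point above `rᵢ`: `z = 0` and `y ≠ 0`.
[folklore] -/
theorem ramification_of_eq {x y z : F} (hxy : x ≠ 0 ∨ y ≠ 0) (hz : z ^ 2 = f.eval x y) (i : Fin 4)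
    (hx : x - R.r i * y = 0) : z = 0 ∧ y ≠ 0 := by
  have hxe : x = R.r i * y := sub_eq_zero.mp hx
  have hy : y ≠ 0 := by
    rcases hxy with h | h
    · rintro rfl; exact h (by rw [hxe, mul_zero])
    · exact h
  refine ⟨?_, hy⟩
  have h0 : f.eval x y = 0 := by
    rw [hxe, show R.r i * y = y * R.r i from mul_comm _ _, show y = y * 1 from (mul_one y).symm,
      mul_assoc, one_mul, eval_scale, R.eval_r, mul_zero]
  rw [h0, sq_eq_zero_iff] at hz
  exact hz

/-- **Torsor compatibility for the roots `r₀, r₁`**: `ψ_{r₁}(Q) = ψ_{r₀}(Q) + T(r₀, r₁)` for every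
point `Q = (x : y : z)` of `z² = f(x, y)` (Cremona 2001, Prop. 4.3 (3): `θ^σ(R) = θ(R) + T_σ`; here
for the conjugate maps `θ_{r₀}`, `θ_{r₁}` directly). [cite: Cremona2001, Prop. 4.3 (3)] -/
theorem psiPt_one_eq_psiPt_zero_add (h2 : (2 : F) ≠ 0) (h3 : (3 : F) ≠ 0) (ha : f.a ≠ 0)
    (hΔ : f.disc ≠ 0) (ht : t ≠ 0) (hI : f.I = -3 * A * t ^ 4) (hJ : f.J = -27 * B * t ^ 6)
    (hE : 4 * A ^ 3 + 27 * B ^ 2 ≠ 0) {x y z : F} (hxy : x ≠ 0 ∨ y ≠ 0) (hz : z ^ 2 = f.eval x y) :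
    psiPt C f t (R.r 1) x y z = psiPt C f t (R.r 0) x y z + torsorPt C f t (R.r 0) (R.r 1) := by
  have hinj := R.injective hΔ
  have h01 : R.r 0 - R.r 1 ≠ 0 := sub_ne_zero.mpr fun h ↦ by simpa using hinj h
  have h01' : (0 : Fin 4) ≠ 1 := by decide
  by_cases hx0 : x - R.r 0 * y = 0
  · -- `Q` is the ramification point above `r₀`
    obtain ⟨rfl, hy⟩ := ramification_of_eq R hxy hz 0 hx0
    have hxe : x = R.r 0 * y := sub_eq_zero.mp hx0
    have hx1 : x - R.r 1 * y ≠ 0 := by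
      rw [hxe, ← sub_mul]; exact mul_ne_zero h01 hy
    rw [psiPt_of_eq_zero f t 0 hx0, zero_add, psiPt_eq_some R hC h2 h3 ht hI hJ hE 1 hx1 hz,
      torsorPt_eq_some hC R ha h3 hΔ ht hI hJ h01']
    simp only [Point.some.injEq]
    constructor
    · have h := psiX_ramification_ofRootVec f.a R.r h2 h3 ht hy h01
      rw [← R.eq_ofRoots] at h
      rw [hxe, h]
    · simp [psiY]
  by_cases hx1 : x - R.r 1 * y = 0
  · -- `Q` is the ramification point above `r₁`
    obtain ⟨rfl, hy⟩ := ramification_of_eq R hxy hz 1 hx1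
    have hxe : x = R.r 1 * y := sub_eq_zero.mp hx1
    rw [psiPt_of_eq_zero f t 0 hx1, psiPt_eq_some R hC h2 h3 ht hI hJ hE 0 hx0 hz]
    -- `ψ_{r₀}(R_{r₁}) = T(r₀, r₁)` and `T + T = O`
    have hT : Point.some _ _ (nonsingular_psi R hC h2 h3 ht hI hJ hE 0 hx0 hz) =
        torsorPt C f t (R.r 0) (R.r 1) := by
      rw [torsorPt_comm, torsorPt_eq_some hC R ha h3 hΔ ht hI hJ h01'.symm]
      simp only [Point.some.injEq]
      constructor
      · have h10 : (R.reindex (Equiv.swap 0 1)).r 0 - (R.reindex (Equiv.swap 0 1)).r 1 ≠ 0 := by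
          simpa using fun h ↦ h01 (by linear_combination -h)
        have h := psiX_ramification_ofRootVec f.a (R.reindex (Equiv.swap 0 1)).r h2 h3 ht hy h10
        rw [← (R.reindex (Equiv.swap 0 1)).eq_ofRoots] at h
        simp only [RootData.reindex_r, Equiv.swap_apply_left, Equiv.swap_apply_right] at h
        rw [hxe, h, torsX_comm]
      · simp [psiY]
    rw [hT, torsorPt_add_self hC]
  -- generic case: chord through `ψ_{r₀}(Q)` and `T(r₀, r₁)`
  rw [psiPt_eq_some R hC h2 h3 ht hI hJ hE 1 hx1 hz, psiPt_eq_some R hC h2 h3 ht hI hJ hE 0 hx0 hz,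
    torsorPt_eq_some hC R ha h3 hΔ ht hI hJ h01']
  have hz' : z ^ 2 = (ofRootVec f.a R.r).eval x y := by rw [← R.eq_ofRoots]; exact hz
  have hsub := psiX_sub_torsX_ofRootVec f.a R.r h2 h3 ht hx0 h01
  rw [← R.eq_ofRoots] at hsub
  have hf1 : derivX f (R.r 0) ≠ 0 := R.derivX_ne_zero ha hΔ 0
  have hne : psiX f t (R.r 0) x y ≠ torsX f t (R.r 0) (R.r 1) := by
    intro h
    rw [h, sub_self, eq_comm, div_eq_zero_iff] at hsub
    rcases hsub with h' | h'
    · exact mul_ne_zero hf1 hx1 h'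
    · exact mul_ne_zero (mul_ne_zero h01 (pow_ne_zero _ ht)) hx0 h'
  rw [Point.add_of_X_ne hne]
  have hslope : C.slope (psiX f t (R.r 0) x y) (torsX f t (R.r 0) (R.r 1)) (psiY f t (R.r 0) x y z) 0 =
      (R.r 0 - R.r 1) * z / (t * (x - R.r 0 * y) * (x - R.r 1 * y)) := by
    rw [slope_of_X_ne hne, sub_zero, hsub, psiY]
    field_simp
  have hX := addX_psi_ofRootVec f.a R.r h2 h3 ht hx0 hx1 hz'
  have hY := addY_psi_ofRootVec f.a R.r z h2 h3 ht hx0 hx1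
  rw [← R.eq_ofRoots] at hX hY
  have haddX : C.addX (psiX f t (R.r 0) x y) (torsX f t (R.r 0) (R.r 1))
      (C.slope (psiX f t (R.r 0) x y) (torsX f t (R.r 0) (R.r 1)) (psiY f t (R.r 0) x y z) 0) =
      psiX f t (R.r 1) x y := by
    rw [Affine.addX, hslope, hC.a₁, hC.a₂, ← hX]; ring
  symm
  simp only [Point.some.injEq]
  refine ⟨haddX, ?_⟩
  rw [Affine.addY, Affine.negAddY, haddX, hC.negY, hslope, ← hY]
  ring

/-- **Torsor compatibility** `ψ_{rⱼ}(Q) = ψ_{rᵢ}(Q) + T(rᵢ, rⱼ)` for any two roots and any point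
`Q` of `z² = f(x, y)`. [cite: Cremona2001, Prop. 4.3 (3)] -/
theorem psiPt_eq_psiPt_add_torsorPt (h2 : (2 : F) ≠ 0) (h3 : (3 : F) ≠ 0) (ha : f.a ≠ 0)
    (hΔ : f.disc ≠ 0) (ht : t ≠ 0) (hI : f.I = -3 * A * t ^ 4) (hJ : f.J = -27 * B * t ^ 6)
    (hE : 4 * A ^ 3 + 27 * B ^ 2 ≠ 0) (i j : Fin 4) {x y z : F} (hxy : x ≠ 0 ∨ y ≠ 0)
    (hz : z ^ 2 = f.eval x y) :
    psiPt C f t (R.r j) x y z = psiPt C f t (R.r i) x y z + torsorPt C f t (R.r i) (R.r j) := by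
  by_cases hij : i = j
  · subst hij; rw [torsorPt_self, add_zero]
  obtain ⟨σ, h0, h1⟩ := exists_perm_fin_four_zero_one hij
  have h := psiPt_one_eq_psiPt_zero_add (R.reindex σ) hC h2 h3 ha hΔ ht hI hJ hE hxy hz
  simpa [h0, h1] using h

end Compat

/-! ## §4 The inverse `χ_u : E → C_f` and functoriality of `ψ_u` -/

section Chi

variable {F : Type*} [Field F] {C : Affine F}

/-- **The inverse map `χ_u : E → C_f`** on triples: `χ_u(O) = (u : 1 : 0)` (the ramification point
above `u`) and `χ_u(X, Y) = (u·X₁ + f₁(u) : X₁ : f₁(u)t³Y)` with `X₁ = t²X − f₂(u)/6`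
(inverting `ψ_u`; Cremona 2001, §4, Prop. 4.3 (2),(5): `θ` is a birational isomorphism). [cite: Cremona2001, §4 Prop. 4.3] -/
def chiTriple (f : BinaryQuartic F) (t u : F) : C.Point → F × F × F
  | 0 => (u, 1, 0)
  | .some X Y _ =>
    (u * (t ^ 2 * X - derivXX f u / 6) + derivX f u, t ^ 2 * X - derivXX f u / 6,
      derivX f u * t ^ 3 * Y)

/-- `χ_u(O) = (u, 1, 0)`. [folklore] -/
@[simp] theorem chiTriple_zero (f : BinaryQuartic F) (t u : F) :
    chiTriple f t u (0 : C.Point) = (u, 1, 0) := rfl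

/-- `χ_u` of an affine point. [folklore] -/
@[simp] theorem chiTriple_some (f : BinaryQuartic F) (t u : F) {X Y : F} (h : C.Nonsingular X Y) :
    chiTriple f t u (.some X Y h) =
      (u * (t ^ 2 * X - derivXX f u / 6) + derivX f u, t ^ 2 * X - derivXX f u / 6,
        derivX f u * t ^ 3 * Y) := rfl

/-- The curve equation for `χ_{r₀}` on `ofRootVec a r`: if `Y² = X³ + AX + B` with
`A = −I/(3t⁴)`, `B = −J/(27t⁶)`, then `(f₁t³Y)² = f(r₀X₁ + f₁, X₁)`, `X₁ = t²X − f₂/6`. [folklore] -/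
theorem chi_equation_ofRootVec (a : F) (r : Fin 4 → F) {t X Y : F} (h2 : (2 : F) ≠ 0)
    (h3 : (3 : F) ≠ 0) (ht : t ≠ 0)
    (hE : Y ^ 2 = X ^ 3 + -(ofRootVec a r).I / (3 * t ^ 4) * X + -(ofRootVec a r).J / (27 * t ^ 6)) :
    (derivX (ofRootVec a r) (r 0) * t ^ 3 * Y) ^ 2 =
      (ofRootVec a r).eval (r 0 * (t ^ 2 * X - derivXX (ofRootVec a r) (r 0) / 6) +
        derivX (ofRootVec a r) (r 0)) (t ^ 2 * X - derivXX (ofRootVec a r) (r 0) / 6) := by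
  have h6 : (6 : F) ≠ 0 := by
    have : (6 : F) = 2 * 3 := by norm_num
    rw [this]; exact mul_ne_zero h2 h3
  have h27 : (27 : F) ≠ 0 := by
    have : (27 : F) = 3 * 3 * 3 := by norm_num
    rw [this]; exact mul_ne_zero (mul_ne_zero h3 h3) h3
  rw [mul_pow, hE]
  simp only [derivX, derivXX, ofRootVec, ofRoots, BinaryQuartic.I, BinaryQuartic.J, BinaryQuartic.eval]
  field_simp
  ring

variable {f : BinaryQuartic F} (R : RootData f) {A B t : F} (hC : IsShortModel C A B)
include hC

/-- **`χ_{rᵢ}` lands on `C_f`**: for `P ∈ E_{A,B}(F)`, the triple `χ_{rᵢ}(P) = (x', y', z')` satisfies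
`z'² = f(x', y')`, `(x', y') ≠ (0, 0)`. [cite: Cremona2001, §4 Prop. 4.3 (2)] -/
theorem chi_mem (h2 : (2 : F) ≠ 0) (h3 : (3 : F) ≠ 0) (ha : f.a ≠ 0) (hΔ : f.disc ≠ 0) (ht : t ≠ 0)
    (hI : f.I = -3 * A * t ^ 4) (hJ : f.J = -27 * B * t ^ 6) (i : Fin 4) (P : C.Point) :
    (chiTriple f t (R.r i) P).2.2 ^ 2 =
        f.eval (chiTriple f t (R.r i) P).1 (chiTriple f t (R.r i) P).2.1 ∧
      ((chiTriple f t (R.r i) P).1 ≠ 0 ∨ (chiTriple f t (R.r i) P).2.1 ≠ 0) := by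
  rcases P with _ | ⟨X, Y, hP⟩
  · refine ⟨?_, Or.inr ?_⟩
    · change (0 : F) ^ 2 = f.eval (R.r i) 1
      rw [R.eval_r]; ring
    · exact one_ne_zero
  · simp only [chiTriple_some]
    refine ⟨?_, ?_⟩
    · obtain ⟨σ, h0⟩ := exists_perm_fin_four_zero i
      have h27 : (27 : F) ≠ 0 := by
        have : (27 : F) = 3 * 3 * 3 := by norm_num
        rw [this]; exact mul_ne_zero (mul_ne_zero h3 h3) h3
      have hE : Y ^ 2 = X ^ 3 + A * X + B := (hC.equation_iff X Y).mp hP.1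
      have hA : A = -f.I / (3 * t ^ 4) := by
        rw [hI]; field_simp
      have hB : B = -f.J / (27 * t ^ 6) := by
        rw [hJ]; field_simp
      set R' := R.reindex σ with hR'
      have hE' : Y ^ 2 = X ^ 3 + -(ofRootVec f.a R'.r).I / (3 * t ^ 4) * X +
          -(ofRootVec f.a R'.r).J / (27 * t ^ 6) := by
        rw [← R'.eq_ofRoots, ← hA, ← hB]; exact hE
      have h := chi_equation_ofRootVec f.a R'.r h2 h3 ht hE'
      rw [← R'.eq_ofRoots] at h
      have hr : R'.r 0 = R.r i := by simp [hR', h0]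
      rw [hr] at h
      exact h
    · by_cases hX1 : t ^ 2 * X - derivXX f (R.r i) / 6 = 0
      · left
        rw [hX1, mul_zero, zero_add]
        exact R.derivX_ne_zero ha hΔ i
      · exact Or.inr hX1

omit hC in
/-- **`ψ_u ∘ χ_u = id`** on `E_{A,B}(F)`. [cite: Cremona2001, §4 Prop. 4.3 (2),(5)] -/
theorem psiPt_chiTriple (h2 : (2 : F) ≠ 0) (h3 : (3 : F) ≠ 0) (ha : f.a ≠ 0) (hΔ : f.disc ≠ 0)
    (ht : t ≠ 0) (i : Fin 4) (P : C.Point) :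
    psiPt C f t (R.r i) (chiTriple f t (R.r i) P).1 (chiTriple f t (R.r i) P).2.1
      (chiTriple f t (R.r i) P).2.2 = P := by
  rcases P with _ | ⟨X, Y, hP⟩
  · exact psiPt_of_eq_zero f t 0 (by change R.r i - R.r i * 1 = 0; ring)
  · simp only [chiTriple_some]
    have hf1 : derivX f (R.r i) ≠ 0 := R.derivX_ne_zero ha hΔ i
    have h6 : (6 : F) ≠ 0 := by
      have : (6 : F) = 2 * 3 := by norm_num
      rw [this]; exact mul_ne_zero h2 h3
    have hx : R.r i * (t ^ 2 * X - derivXX f (R.r i) / 6) + derivX f (R.r i) -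
        R.r i * (t ^ 2 * X - derivXX f (R.r i) / 6) ≠ 0 := by
      rwa [add_sub_cancel_left]
    have hX : psiX f t (R.r i) (R.r i * (t ^ 2 * X - derivXX f (R.r i) / 6) + derivX f (R.r i))
        (t ^ 2 * X - derivXX f (R.r i) / 6) = X := by
      rw [psiX, add_sub_cancel_left]
      field_simp
      ring
    have hY : psiY f t (R.r i) (R.r i * (t ^ 2 * X - derivXX f (R.r i) / 6) + derivX f (R.r i))
        (t ^ 2 * X - derivXX f (R.r i) / 6) (derivX f (R.r i) * t ^ 3 * Y) = Y := by
      rw [psiY, add_sub_cancel_left]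
      field_simp
    have hns : C.Nonsingular
        (psiX f t (R.r i) (R.r i * (t ^ 2 * X - derivXX f (R.r i) / 6) + derivX f (R.r i))
          (t ^ 2 * X - derivXX f (R.r i) / 6))
        (psiY f t (R.r i) (R.r i * (t ^ 2 * X - derivXX f (R.r i) / 6) + derivX f (R.r i))
          (t ^ 2 * X - derivXX f (R.r i) / 6) (derivX f (R.r i) * t ^ 3 * Y)) := by
      rw [hX, hY]; exact hP
    rw [psiPt_of_nonsingular hx hns]
    simp only [Point.some.injEq]
    exact ⟨hX, hY⟩

/-- **`χ_u ∘ ψ_u ∼ id`** on `C_f`: `χ_{rᵢ}(ψ_{rᵢ}(x : y : z)) = (λx, λy, λ²z)` for some `λ ≠ 0`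
(`λ = f₁(rᵢ)/(x − rᵢy)` off the ramification point, `λ = 1/y` at it). [cite: Cremona2001, §4 Prop. 4.3 (2),(5)] -/
theorem chiTriple_psiPt (h2 : (2 : F) ≠ 0) (h3 : (3 : F) ≠ 0) (ha : f.a ≠ 0) (hΔ : f.disc ≠ 0)
    (ht : t ≠ 0) (hI : f.I = -3 * A * t ^ 4) (hJ : f.J = -27 * B * t ^ 6)
    (hE : 4 * A ^ 3 + 27 * B ^ 2 ≠ 0) (i : Fin 4) {x y z : F} (hxy : x ≠ 0 ∨ y ≠ 0)
    (hz : z ^ 2 = f.eval x y) :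
    ∃ l : F, l ≠ 0 ∧ chiTriple f t (R.r i) (psiPt C f t (R.r i) x y z) = (l * x, l * y, l ^ 2 * z) := by
  by_cases hx : x - R.r i * y = 0
  · obtain ⟨rfl, hy⟩ := ramification_of_eq R hxy hz i hx
    have hxe : x = R.r i * y := sub_eq_zero.mp hx
    refine ⟨y⁻¹, inv_ne_zero hy, ?_⟩
    rw [psiPt_of_eq_zero f t _ hx, chiTriple_zero, hxe]
    ext
    · field_simp
    · field_simp
    · simp
  · have hf1 : derivX f (R.r i) ≠ 0 := R.derivX_ne_zero ha hΔ i
    have h6 : (6 : F) ≠ 0 := by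
      have : (6 : F) = 2 * 3 := by norm_num
      rw [this]; exact mul_ne_zero h2 h3
    refine ⟨derivX f (R.r i) / (x - R.r i * y), div_ne_zero hf1 hx, ?_⟩
    rw [psiPt_eq_some R hC h2 h3 ht hI hJ hE i hx hz, chiTriple_some]
    have hX1 : t ^ 2 * psiX f t (R.r i) x y - derivXX f (R.r i) / 6 =
        derivX f (R.r i) / (x - R.r i * y) * y := by
      rw [psiX]; field_simp; ring
    ext
    · rw [hX1]; field_simp; ring
    · exact hX1
    · change derivX f (R.r i) * t ^ 3 * psiY f t (R.r i) x y z = _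
      rw [psiY]; field_simp

/-- **`ψ_u` is injective up to the weighted scaling**: if `ψ_{rᵢ}(Q) = ψ_{rᵢ}(Q')` for points
`Q = (x : y : z)`, `Q' = (x' : y' : z')` of `C_f`, then `Q' = (λx, λy, λ²z)` for some `λ ≠ 0`. [folklore] -/
theorem psiPt_injective (h2 : (2 : F) ≠ 0) (h3 : (3 : F) ≠ 0) (ha : f.a ≠ 0) (hΔ : f.disc ≠ 0)
    (ht : t ≠ 0) (hI : f.I = -3 * A * t ^ 4) (hJ : f.J = -27 * B * t ^ 6)
    (hE : 4 * A ^ 3 + 27 * B ^ 2 ≠ 0) (i : Fin 4) {x y z x' y' z' : F} (hxy : x ≠ 0 ∨ y ≠ 0)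
    (hz : z ^ 2 = f.eval x y) (hxy' : x' ≠ 0 ∨ y' ≠ 0) (hz' : z' ^ 2 = f.eval x' y')
    (heq : psiPt C f t (R.r i) x y z = psiPt C f t (R.r i) x' y' z') :
    ∃ l : F, l ≠ 0 ∧ x' = l * x ∧ y' = l * y ∧ z' = l ^ 2 * z := by
  obtain ⟨l, hl, h⟩ := chiTriple_psiPt R hC h2 h3 ha hΔ ht hI hJ hE i hxy hz
  obtain ⟨l', hl', h'⟩ := chiTriple_psiPt R hC h2 h3 ha hΔ ht hI hJ hE i hxy' hz'
  rw [heq, h'] at h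
  simp only [Prod.mk.injEq] at h
  obtain ⟨h1, h2', h3'⟩ := h
  refine ⟨l / l', div_ne_zero hl hl', ?_, ?_, ?_⟩
  · field_simp; linear_combination h1
  · field_simp; linear_combination h2'
  · field_simp; linear_combination h3'

end Chi

/-! ### Functoriality of `ψ_u` in the field -/

section MapPsi

variable {R₀ S₀ K L : Type*} [CommRing R₀] [CommRing S₀] [Field K] [Field L] [Algebra R₀ S₀]
  [Algebra R₀ K] [Algebra S₀ K] [IsScalarTower R₀ S₀ K] [Algebra R₀ L] [Algebra S₀ L]
  [IsScalarTower R₀ S₀ L] (W : WeierstrassCurve R₀) (ψ : K →ₐ[S₀] L)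

/-- **Functoriality of `ψ_u`**: a field homomorphism applied to the coordinates carries
`ψ_u(x : y : z)` (on `E ⁄ K` from `f`, `t`) to `ψ_{φu}(φx : φy : φz)` (on `E ⁄ L` from `φf`,
`φt`); in particular `σ(ψ_u(Q)) = ψ_{σu}(σQ)` (`θ_u^σ = θ_{σu}`). [folklore] -/
theorem map_psiPt (f : BinaryQuartic K) (t u x y z : K) :
    Point.map ψ (psiPt (W.baseChange K).toAffine f t u x y z) =
      psiPt (W.baseChange L).toAffine (f.map (ψ : K →+* L)) (ψ t) (ψ u) (ψ x) (ψ y) (ψ z) := by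
  have hinj : Function.Injective ψ := (ψ : K →+* L).injective
  have hX : psiX (f.map (ψ : K →+* L)) (ψ t) (ψ u) (ψ x) (ψ y) = ψ (psiX f t u x y) :=
    psiX_map (ψ : K →+* L) f t u x y
  have hY : psiY (f.map (ψ : K →+* L)) (ψ t) (ψ u) (ψ x) (ψ y) (ψ z) = ψ (psiY f t u x y z) :=
    psiY_map (ψ : K →+* L) f t u x y z
  have hx : ψ x - ψ u * ψ y = ψ (x - u * y) := by simp
  by_cases h : x - u * y ≠ 0 ∧ (W.baseChange K).toAffine.Nonsingular (psiX f t u x y) (psiY f t u x y z)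
  · have h' : ψ x - ψ u * ψ y ≠ 0 ∧ (W.baseChange L).toAffine.Nonsingular
        (psiX (f.map (ψ : K →+* L)) (ψ t) (ψ u) (ψ x) (ψ y))
        (psiY (f.map (ψ : K →+* L)) (ψ t) (ψ u) (ψ x) (ψ y) (ψ z)) := by
      refine ⟨by rw [hx]; exact (map_ne_zero ψ).mpr h.1, ?_⟩
      rw [hX, hY]
      exact (baseChange_nonsingular (W := W.toAffine) hinj _ _).mpr h.2
    rw [psiPt, dif_pos h, psiPt, dif_pos h', Point.map_some]
    simp only [Point.some.injEq]
    exact ⟨hX.symm, hY.symm⟩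
  · have h' : ¬(ψ x - ψ u * ψ y ≠ 0 ∧ (W.baseChange L).toAffine.Nonsingular
        (psiX (f.map (ψ : K →+* L)) (ψ t) (ψ u) (ψ x) (ψ y))
        (psiY (f.map (ψ : K →+* L)) (ψ t) (ψ u) (ψ x) (ψ y) (ψ z))) := by
      rintro ⟨hne, hns⟩
      refine h ⟨fun e ↦ hne (by rw [hx, e, map_zero]), ?_⟩
      rw [hX, hY] at hns
      exact (baseChange_nonsingular (W := W.toAffine) hinj _ _).mp hns
    rw [psiPt, dif_neg h, psiPt, dif_neg h', Point.map_zero]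

end MapPsi

/-! ## §5 The local torsor lemma -/

section TorsorLemma

variable {R₀ K Ω : Type*} [CommRing R₀] [Field K] [Field Ω] [Algebra R₀ Ω] [Algebra K Ω]

variable {W : WeierstrassCurve R₀} {g : BinaryQuartic K} {A B t : K} {r₀ : Ω}

/-- `Δ(g) ≠ 0` for a set-up, assuming only `27 ≠ 0` in `K` (file II's `Setup.disc_ne_zero` assumes
`CharZero`). [folklore] -/
theorem Setup.disc_ne_zero_of_ne (h : Setup g A B t) (h27 : (27 : K) ≠ 0) : g.disc ≠ 0 := by
  rw [h.disc_eq h27]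
  exact neg_ne_zero.mpr (mul_ne_zero (pow_ne_zero _ h.t_ne) h.disc_ne)

/-- `27 ≠ 0` from `3 ≠ 0`. [folklore] -/
theorem twentySeven_ne_zero {F : Type*} [Field F] (h3 : (3 : F) ≠ 0) : (27 : F) ≠ 0 := by
  have : (27 : F) = 3 * 3 * 3 := by norm_num
  rw [this]; exact mul_ne_zero (mul_ne_zero h3 h3) h3

/-- A `K`-automorphism of `Ω` fixes `ψ_u` up to moving the root: for `x, y, z, t ∈ K`,
`σ(ψ_u(x : y : z)) = ψ_{σu}(x : y : z)`. [folklore] -/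
theorem map_psiPt_algebraMap (ψ : Ω →ₐ[R₀] Ω) (σ : Ω ≃ₐ[K] Ω) (hψ : ∀ x, ψ x = σ x) (u : Ω)
    (x y z : K) :
    Point.map ψ (psiPt (W.baseChange Ω).toAffine (g.map (algebraMap K Ω)) (algebraMap K Ω t) u
      (algebraMap K Ω x) (algebraMap K Ω y) (algebraMap K Ω z)) =
      psiPt (W.baseChange Ω).toAffine (g.map (algebraMap K Ω)) (algebraMap K Ω t) (σ u)
        (algebraMap K Ω x) (algebraMap K Ω y) (algebraMap K Ω z) := by
  rw [map_psiPt W ψ, map_map_algebraMap ψ σ hψ]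
  simp [hψ]

/-- **Soluble ⇒ coboundary.** If `z² = g(x, y)` has a `K`-rational point `Q`, then the cocycle
`σ ↦ T(r₀, σ r₀)` of `Gal(Ω/K)` is the coboundary of `P = ψ_{r₀}(Q) ∈ E(Ω)`:
`T(r₀, σ r₀) = σP − P`, since `σ(ψ_{r₀}(Q)) = ψ_{σr₀}(σQ) = ψ_{σr₀}(Q) = ψ_{r₀}(Q) + T(r₀, σr₀)`
(Cremona 2001, §5: soluble `2`-coverings give cocycles "trivial in `H¹(Gal(K̄/K), E)`, as is
evident from their representation as the coboundary `Q^σ − Q` with `Q = θ(R)`"). The action of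
`σ` on `E(Ω)` is `Point.map ψ` for any `R₀`-algebra map `ψ` agreeing with `σ`; `R` is root data
for `g` over `Ω`. [cite: Cremona2001, §5 (soluble 2-coverings are coboundaries Q^σ − Q) and Prop. 4.3 (3)] -/
theorem exists_eq_map_sub_of_isSoluble (h2 : (2 : Ω) ≠ 0) (h3 : (3 : Ω) ≠ 0) (h : Setup g A B t)
    (R : RootData (g.map (algebraMap K Ω)))
    (hC : IsShortModel (W.baseChange Ω).toAffine (algebraMap K Ω A) (algebraMap K Ω B))
    (hr₀ : (g.map (algebraMap K Ω)).eval r₀ 1 = 0) (hsol : g.IsSoluble) :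
    ∃ P : (W.baseChange Ω).toAffine.Point, ∀ (ψ : Ω →ₐ[R₀] Ω) (σ : Ω ≃ₐ[K] Ω),
      (∀ x, ψ x = σ x) → cocycleFun W g t r₀ σ = Point.map ψ P - P := by
  have hΩ := h.map (algebraMap K Ω)
  obtain ⟨x, y, z, hxy, hz⟩ := hsol
  set gΩ := g.map (algebraMap K Ω)
  set tΩ := algebraMap K Ω t
  have hzΩ : algebraMap K Ω z ^ 2 = gΩ.eval (algebraMap K Ω x) (algebraMap K Ω y) := by
    rw [eval_map, ← hz, map_pow]
  have hxyΩ : algebraMap K Ω x ≠ 0 ∨ algebraMap K Ω y ≠ 0 := by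
    rcases hxy with hx | hy
    · exact Or.inl ((map_ne_zero _).mpr hx)
    · exact Or.inr ((map_ne_zero _).mpr hy)
  refine ⟨psiPt (W.baseChange Ω).toAffine gΩ tΩ r₀ (algebraMap K Ω x) (algebraMap K Ω y)
    (algebraMap K Ω z), fun ψ σ hψ ↦ ?_⟩
  obtain ⟨i, hi⟩ := exists_eq_r R h.a_ne hr₀
  obtain ⟨j, hj⟩ := exists_eq_r R h.a_ne (eval_apply_eq_zero σ hr₀)
  rw [map_psiPt_algebraMap ψ σ hψ, cocycleFun_apply, hj, hi,
    psiPt_eq_psiPt_add_torsorPt R hC h2 h3 hΩ.a_ne (hΩ.disc_ne_zero_of_ne (twentySeven_ne_zero h3))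
      hΩ.t_ne hΩ.I_eq hΩ.J_eq hΩ.disc_ne i j hxyΩ hzΩ, add_sub_cancel_left]

/-- **Coboundary ⇒ soluble.** Conversely, if `T(r₀, σ r₀) = σP − P` for some `P ∈ E(Ω)` and all
`σ ∈ Gal(Ω/K)`, and `Ω^{Gal(Ω/K)} = K` (`hfix`; e.g. `Ω = K̄`, `K` perfect), then `z² = g(x, y)`
has a `K`-rational point: `Q = χ_{r₀}(P)` satisfies `ψ_{σr₀}(σQ) = σP = P + T(r₀, σr₀) =
ψ_{σr₀}(Q)`, so `σQ ∼ Q` for all `σ`, and the normalised coordinates of `Q` lie in `K`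
(Cremona 2001, Prop. 4.3 (4)–(5) and §5; Cassels, LEC §23: "being in the kernel means … that
there is a point on `𝒟` defined over `ℚ_p`"). [cite: Cremona2001, Prop. 4.3 (4),(5) and §5] -/
theorem isSoluble_of_forall_eq_map_sub (h2 : (2 : Ω) ≠ 0) (h3 : (3 : Ω) ≠ 0) (h : Setup g A B t)
    (R : RootData (g.map (algebraMap K Ω)))
    (hC : IsShortModel (W.baseChange Ω).toAffine (algebraMap K Ω A) (algebraMap K Ω B))
    (hr₀ : (g.map (algebraMap K Ω)).eval r₀ 1 = 0)
    (hfix : ∀ x : Ω, (∀ σ : Ω ≃ₐ[K] Ω, σ x = x) → ∃ x₀ : K, algebraMap K Ω x₀ = x)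
    (ψ : (Ω ≃ₐ[K] Ω) → (Ω →ₐ[R₀] Ω)) (hψ : ∀ σ x, ψ σ x = σ x)
    {P : (W.baseChange Ω).toAffine.Point}
    (hP : ∀ σ : Ω ≃ₐ[K] Ω, cocycleFun W g t r₀ σ = Point.map (ψ σ) P - P) : g.IsSoluble := by
  have hΩ := h.map (algebraMap K Ω)
  set gΩ := g.map (algebraMap K Ω) with hgΩ
  set tΩ := algebraMap K Ω t with htΩ
  obtain ⟨i, hi⟩ := exists_eq_r R h.a_ne hr₀
  have hΔ : (g.map (algebraMap K Ω)).disc ≠ 0 := hΩ.disc_ne_zero_of_ne (twentySeven_ne_zero h3)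
  -- the candidate point `Q = χ_{r₀}(P)`
  set x := (chiTriple gΩ tΩ (R.r i) P).1 with hxdef
  set y := (chiTriple gΩ tΩ (R.r i) P).2.1 with hydef
  set z := (chiTriple gΩ tΩ (R.r i) P).2.2 with hzdef
  obtain ⟨hz, hxy⟩ := chi_mem R hC h2 h3 hΩ.a_ne hΔ hΩ.t_ne hΩ.I_eq hΩ.J_eq i P
  change z ^ 2 = gΩ.eval x y at hz
  change x ≠ 0 ∨ y ≠ 0 at hxy
  have hQ : psiPt (W.baseChange Ω).toAffine gΩ tΩ (R.r i) x y z = P :=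
    psiPt_chiTriple R h2 h3 hΩ.a_ne hΔ hΩ.t_ne i P
  -- `σQ ∼ Q` for every `σ`
  have hscale : ∀ σ : Ω ≃ₐ[K] Ω, ∃ l : Ω, l ≠ 0 ∧ σ x = l * x ∧ σ y = l * y ∧ σ z = l ^ 2 * z := by
    intro σ
    obtain ⟨j, hj⟩ := exists_eq_r R h.a_ne (eval_apply_eq_zero σ hr₀)
    have hzσ : σ z ^ 2 = gΩ.eval (σ x) (σ y) := by
      have key : gΩ.eval (σ x) (σ y) = σ (gΩ.eval x y) := by
        simp [hgΩ, BinaryQuartic.eval, BinaryQuartic.map]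
      rw [key, ← hz, map_pow]
    have hxyσ : σ x ≠ 0 ∨ σ y ≠ 0 := by
      rcases hxy with hx | hy
      · exact Or.inl ((map_ne_zero σ).mpr hx)
      · exact Or.inr ((map_ne_zero σ).mpr hy)
    -- `ψ_{σr₀}(σQ) = σ(ψ_{r₀}(Q)) = σP = P + T(r₀, σr₀) = ψ_{σr₀}(Q)`
    have h1 : psiPt (W.baseChange Ω).toAffine gΩ tΩ (R.r j) (σ x) (σ y) (σ z) =
        Point.map (ψ σ) P := by
      have hm := map_psiPt W (ψ σ) gΩ tΩ (R.r i) x y z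
      rw [hQ, map_map_algebraMap (ψ σ) σ (hψ σ)] at hm
      rw [hm]
      simp only [hψ, htΩ, AlgEquiv.commutes]
      rw [← hi, hj]
    have h2' : psiPt (W.baseChange Ω).toAffine gΩ tΩ (R.r j) x y z = Point.map (ψ σ) P := by
      rw [psiPt_eq_psiPt_add_torsorPt R hC h2 h3 hΩ.a_ne hΔ hΩ.t_ne hΩ.I_eq hΩ.J_eq
        hΩ.disc_ne i j hxy hz, hQ, ← hi, ← hj, ← cocycleFun_apply, hP σ, add_sub_cancel]
    exact psiPt_injective R hC h2 h3 hΩ.a_ne hΔ hΩ.t_ne hΩ.I_eq hΩ.J_eq hΩ.disc_ne j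
      hxy hz hxyσ hzσ (h2'.trans h1.symm)
  -- normalise and descend to `K`
  by_cases hy0 : y = 0
  · have hx0 : x ≠ 0 := hxy.resolve_right (not_not.mpr hy0)
    have hfz : ∀ σ : Ω ≃ₐ[K] Ω, σ (z / x ^ 2) = z / x ^ 2 := by
      intro σ
      obtain ⟨l, hl, hx', -, hz'⟩ := hscale σ
      rw [map_div₀, map_pow, hx', hz']
      field_simp
    obtain ⟨z₁, hz₁⟩ := hfix _ hfz
    have hev : gΩ.eval 1 0 = gΩ.eval x y / x ^ 4 := by
      have hh := eval_scale gΩ x⁻¹ x y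
      rw [inv_mul_cancel₀ hx0, hy0, mul_zero] at hh
      rw [hy0, hh]
      field_simp
    refine ⟨1, 0, z₁, Or.inl one_ne_zero, ?_⟩
    apply (algebraMap K Ω).injective
    have hem := eval_map (algebraMap K Ω) g 1 0
    rw [map_one, map_zero] at hem
    rw [map_pow, hz₁, ← hem, ← hgΩ, hev, ← hz]
    field_simp
  · have hfx : ∀ σ : Ω ≃ₐ[K] Ω, σ (x / y) = x / y := by
      intro σ
      obtain ⟨l, hl, hx', hy', -⟩ := hscale σ
      rw [map_div₀, hx', hy']
      field_simp
    have hfz : ∀ σ : Ω ≃ₐ[K] Ω, σ (z / y ^ 2) = z / y ^ 2 := by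
      intro σ
      obtain ⟨l, hl, -, hy', hz'⟩ := hscale σ
      rw [map_div₀, map_pow, hy', hz']
      field_simp
    obtain ⟨x₁, hx₁⟩ := hfix _ hfx
    obtain ⟨z₁, hz₁⟩ := hfix _ hfz
    have hev : gΩ.eval (x / y) 1 = gΩ.eval x y / y ^ 4 := by
      have hh := eval_scale gΩ y⁻¹ x y
      rw [inv_mul_cancel₀ hy0, ← div_eq_inv_mul] at hh
      rw [hh]
      field_simp
    refine ⟨x₁, 1, z₁, Or.inr one_ne_zero, ?_⟩
    apply (algebraMap K Ω).injective
    have hem := eval_map (algebraMap K Ω) g x₁ 1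
    rw [map_one, hx₁] at hem
    rw [map_pow, hz₁, ← hem, ← hgΩ, hev, ← hz]
    field_simp

end TorsorLemma

/-! ## §6 Over `ℚ`: the local Selmer condition is local solubility -/

section RatLocal

open IsDedekindDomain NumberField


variable {AB : ℤ × ℤ} {g : BinaryQuartic ℚ} {t : ℚ} {r₀ : AlgebraicClosure ℚ}

/-- **The local conditions are local solubility.** For a binary quartic `g` over `ℚ` in the
`E_{A,B}`-family with root `r₀ ∈ ℚ̄` and a `ℚ`-field `E` of characteristic `0` (a completion
`ℚ_v`), the Selmer class of `g` lies in the local kernel `ker (H¹(ℚ, E[2]) → H¹(E, E_{A,B}(Ē)))` iff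
`z² = g(x, y)` is soluble over `E` (files II–III: cocycle form of the local condition, and the
local torsor lemma over `E` with `Ē^{Γ_E} = E`). This is the local half of Bhargava–Shankar's
Lemma 5.2 / Cassels LEC §23. [cite: BhargavaShankarAnnals2015, Lemma 5.2 (arXiv:1006.1002v2 numbering)] -/
theorem selmerClass_mem_selmerLocalKer_iff_isSoluble (h : Setup g (AB.1 : ℚ) (AB.2 : ℚ) t)
    (hr₀ : (g.map (algebraMap ℚ (AlgebraicClosure ℚ))).eval r₀ 1 = 0)
    (E : Type) [Field E] [Algebra ℚ E] :
    selmerClass h hr₀ ∈ selmerLocalKer (shortWeierstrass AB) E 2 ↔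
      (g.map (algebraMap ℚ E)).IsSoluble := by
  rw [selmerClass_mem_selmerLocalKer_iff]
  -- a `ℚ`-field has characteristic `0`
  have h2 : (2 : AlgebraicClosure E) ≠ 0 := by
    rw [show (2 : AlgebraicClosure E) = algebraMap ℚ (AlgebraicClosure E) 2 by simp]
    exact (map_ne_zero _).mpr (by norm_num)
  have h3 : (3 : AlgebraicClosure E) ≠ 0 := by
    rw [show (3 : AlgebraicClosure E) = algebraMap ℚ (AlgebraicClosure E) 3 by simp]
    exact (map_ne_zero _).mpr (by norm_num)
  -- data over `E`
  have hE : Setup (g.map (algebraMap ℚ E)) (algebraMap ℚ E (AB.1 : ℚ)) (algebraMap ℚ E (AB.2 : ℚ))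
      (algebraMap ℚ E t) := h.map (algebraMap ℚ E)
  have hC : IsShortModel ((shortWeierstrass AB).baseChange (AlgebraicClosure E)).toAffine
      (algebraMap E (AlgebraicClosure E) (algebraMap ℚ E (AB.1 : ℚ)))
      (algebraMap E (AlgebraicClosure E) (algebraMap ℚ E (AB.2 : ℚ))) := by
    rw [← IsScalarTower.algebraMap_apply, ← IsScalarTower.algebraMap_apply]
    exact isShortModel_ratCast AB _
  have hmap : (g.map (algebraMap ℚ E)).map (algebraMap E (AlgebraicClosure E)) =
      g.map (algebraMap ℚ (AlgebraicClosure E)) := by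
    ext <;> simp [BinaryQuartic.map]
  have hρ : ((g.map (algebraMap ℚ E)).map (algebraMap E (AlgebraicClosure E))).eval
      (closureEmb (K := ℚ) E r₀) 1 = 0 := by
    have key : (g.map (algebraMap ℚ (AlgebraicClosure E))).eval (closureEmb (K := ℚ) E r₀) 1 =
        closureEmb (K := ℚ) E ((g.map (algebraMap ℚ (AlgebraicClosure ℚ))).eval r₀ 1) := by
      simp [BinaryQuartic.eval, BinaryQuartic.map]
    rw [hmap, key, hr₀, map_zero]
  obtain ⟨R⟩ := RootData.nonempty (f := (g.map (algebraMap ℚ E)).map (algebraMap E (AlgebraicClosure E)))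
    (show algebraMap E (AlgebraicClosure E) (algebraMap ℚ E g.a) ≠ 0 from
      (map_ne_zero _).mpr ((map_ne_zero _).mpr h.a_ne))
  have hfix : ∀ x : AlgebraicClosure E,
      (∀ σ : AlgebraicClosure E ≃ₐ[E] AlgebraicClosure E, σ x = x) → ∃ x₀ : E, algebraMap E _ x₀ = x := by
    intro x hx
    haveI : CharZero E := charZero_of_injective_algebraMap (algebraMap ℚ E).injective
    haveI : IsGalois E (AlgebraicClosure E) := IsAlgClosure.isGalois E _
    exact (InfiniteGalois.mem_range_algebraMap_iff_fixed x).mpr hx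
  -- the action of `Γ_E` on `E_{A,B}(Ē)` as `Point.map`
  let ψ : (AlgebraicClosure E ≃ₐ[E] AlgebraicClosure E) → (AlgebraicClosure E →ₐ[ℚ] AlgebraicClosure E) :=
    fun σ ↦ ((AlgEquiv.restrictScalars ℚ σ : AlgebraicClosure E ≃ₐ[ℚ] AlgebraicClosure E) :
      AlgebraicClosure E →ₐ[ℚ] AlgebraicClosure E)
  have bridge : ∀ (P : localPoints (shortWeierstrass AB) E) (σ : Field.absoluteGaloisGroup E),
      (localCocycleFun AB g t E (closureEmb (K := ℚ) E r₀) σ = σ • P - P ↔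
        cocycleFun (shortWeierstrass AB) (g.map (algebraMap ℚ E)) (algebraMap ℚ E t)
            (closureEmb (K := ℚ) E r₀) (show AlgebraicClosure E ≃ₐ[E] AlgebraicClosure E from σ) =
          Point.map (ψ (show AlgebraicClosure E ≃ₐ[E] AlgebraicClosure E from σ))
            (show ((shortWeierstrass AB).baseChange (AlgebraicClosure E)).toAffine.Point from P) -
            (show ((shortWeierstrass AB).baseChange (AlgebraicClosure E)).toAffine.Point from P)) :=
    fun _ _ ↦ Iff.rfl
  constructor
  · rintro ⟨P, hP⟩
    exact isSoluble_of_forall_eq_map_sub (W := shortWeierstrass AB) h2 h3 hE R hC hρ hfix ψ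
      (fun _ _ ↦ rfl)
      (P := show ((shortWeierstrass AB).baseChange (AlgebraicClosure E)).toAffine.Point from P)
      fun σ ↦ (bridge P σ).mp (hP σ)
  · intro hsol
    obtain ⟨P, hP⟩ := exists_eq_map_sub_of_isSoluble (W := shortWeierstrass AB) h2 h3 hE R hC hρ hsol
    exact ⟨(show localPoints (shortWeierstrass AB) E from P), fun σ ↦ (bridge _ σ).mpr
      (hP (ψ (show AlgebraicClosure E ≃ₐ[E] AlgebraicClosure E from σ))
        (show AlgebraicClosure E ≃ₐ[E] AlgebraicClosure E from σ) fun _ ↦ rfl)⟩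

end RatLocal


end TwoCovering

end Literature.NumberTheory.EllipticCurves
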